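import Summits.NavierStokesRegularity.FluidComputer.PalasekTowerRegisterGlobalFirstHitting
import Summits.NavierStokesRegularity.FluidComputer.PalasekTowerRegisterGlobalHeredity

/-!
# The τ₁ faces of the register as universal Navier–Stokes constants, I: the two bound predicates, the window numbers,
# and `NoStageAbove k` (crux idea `universal-face-constants`, stmt-NavierStokesRegularity-19179)

Cell `ns-blowup`, seat `ns-palasek-19179-p2` (g2; holder of record of the crux `EpisodeBase` = `EpisodeBaseG` of the route
`PalasekTowerBreakdown`, item stmt-NavierStokesRegularity-19179, line `slot`). VOCABULARY of the crux idea card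
`Cruxes/EpisodeBase/Ideas/universal-face-constants.md` (seat `ns-plan-lens-dual` g0, 19179 evidence #53/#54,
`Sketch-universal-face-constants.lean` c321aa3260e3e6cd; critic ns-mechcritic-2: reduces-to ⇒ NEW-COMBINATION, evidence
#58, USE (a) «land the necessity lemmas as M-lemmas»; refuter4 K90 typed read), kept verbatim up to the namespace, plus the
bookkeeping lemmas the proofs need. The necessity lemmas themselves (PROVED) are the sequel `PalasekTowerFaceNecessity.lean`.
LABEL: E–C typing (KERNEL vocabulary). WHAT THIS IS NOT: not Navier–Stokes evidence — nothing is asserted about the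
universal constants `κ(s, φ)` / `𝔄(s, c, φ)` (the `…Bound` predicates are HYPOTHESES with free constants, `@[conjecture]`)
and nothing about `EpisodeBaseG`.

## Dictionary (wide rates `N₀ = 256`, `b = 11/10`, `β = 23/10`; `Rigid`: `c₁ = 1`, `c₂ = 5/3`, `c₅ = 4bβ`; `ν = 1`)

Window `k` is `[τ_k, τ_{k+1}]`, of length `w_k = 4bβ log N_{k+1} / A_k` (`Rigid.window_eq`; `window_eq_of_rigid`).
* CEILING units: `M = c₂ Y_{k+1}` bounds the speed on `[0, τ_{k+1}]` (`Stage.ceiling (k+1)`); `windowCeil k = w_k M²`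
  (`= 3826.5` at `k = 0`); the strain floor at `τ_{k+1}` reads `‖∇u‖ ≥ c₁ A_{k+1} = gradFloorCeil k · M²`
  (`gradFloorCeil 0 = 0.0578`); the window force `‖f‖ ≤ c₄ Y_k ≤ Y_k = forceCeil k · M³` (`Schedule.push_small`,
  POINTWISE on the whole closed window — refuter4 K90 (2)'s proviso holds by the `Schedule` field — and `c₄ ≤ c₁ = 1`:
  `force_le_Y_of_rigid`).
* START units: `m = c₂ Y_k` bounds the speed at `τ_k` (`Stage.ceiling k`); `windowStart k = w_k m²`, running bound
  `runRatio k · m = c₂ Y_{k+1}`, floor `floorOverStart k · m = c₁ Y_{k+1}`, force `forceStart k · m³ = Y_k`.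
* ANCHORED level `0`: the global anchor sharpens the start speed to `c₁ Y₀ = Y₀` EVERYWHERE at `τ₀`
  (`Stage.norm_τ_zero_le`): window `windowAnch = w₀ Y₀² = 325.8`, running bound `runAnch = (5/3) Y₁ / Y₀ = 3.427`,
  floor ratio `floorAnch = Y₁ / Y₀ = 2.056`, force `forceAnch · Y₀³ = Y₀`.

## Contents

* §1 `GradientProductionBound s φ κ` («κ(s, φ) ≤ κ») and `SpeedAmplificationBound s c φ a` («𝔄(s, c, φ) ≤ a») for
  finite-energy classical forced NS at `ν = 1` on a slab; monotone in the constant; the speed predicate is trivially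
  true with `a = c` (`speedAmplificationBound_of_le`) — its content is `a < c`;
* §2 the register's window numbers as real expressions; `window_eq_of_rigid`, `window_pos`, `force_le_Y_of_rigid`;
* §3 `NoStageAbove k` (level `k + 1` is empty over pinned rigid quiet wide schedules) = `¬ RungG (k + 1)`
  (`noStageAbove_iff_not_rungG`), monotone in `k`, `NoStageAbove 0 ↔ ¬ EpisodeBaseG`; and its by-name reading on the
  heredity items: `NoStageAbove k → HeredityFrom (k + 1)` (VACUOUSLY — a sterile closure, flagged as such) and
  `RungG (k + 1) → NoStageAbove (k + 1) → ¬ HeredityAt (k + 1)` (at `k = 0`: `EpisodeBaseG → NoStageAbove 1 →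
  ¬ HeredityAtOne`).

Honest reading (critic #58, refuter4 K90 (3)): no explicit value of either constant is in print (nearest printed shape:
Kreiss–Lorenz 2004, a-priori estimates in terms of the maximum norm; GIM 1999 / KNSS 2009 / Seregin 2014 Prop. 3.9
constants non-numeric); the closed-form envelope puts the level-`0` gradient face within a factor `2` of a strained Burgers
element EITHER WAY and the speed faces within reach of a Burgers spin-up, so the doors built on this vocabulary are METERS
for primal designs (report `κ_lb`, `𝔄_lb` achieved) rather than expected kills. Nothing here decides the crux.

References: S. Palasek, arXiv:2605.13827 §3.3, §4 [cite: Palasek2026ElementaryModel, §3.3]; H.-O. Kreiss, J. Lorenz,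
J. Differential Equations 203 (2004) 216–231; Y. Giga, K. Inui, S. Matsui, Quaderni di Matematica 4 (1999);
G. Seregin, *Lecture Notes on Regularity Theory for the Navier–Stokes Equations* (2014), Prop. 3.9 (bounded mild
ancient solutions are smooth with bounded derivatives — the qualitative `κ(∞) < ∞`) [cite: Seregin2014, Prop. 3.9].
-/


noncomputable section

namespace Summit.NavierStokesRegularity.FluidComputer.PalasekTowerClayBridge

open Set MeasureTheory Filter Topology Function
open scoped ENNReal ContDiff NNReal
open Literature.Analysis.FluidPDE

namespace UniversalFace

/-! ## §1 The two universal-bound predicates (hypotheses with free constants; nothing asserted) -/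

/-- «κ(s, φ) ≤ κ» — GRADIENT-PRODUCTION BOUND for finite-energy classical Navier–Stokes flows at unit viscosity on
a slab `[t₀, t₀ + T] × ℝ³` with `T · M² = s`: speed `≤ M` and force `≤ φ M³` on the slab put the velocity gradient
(operator norm of the Fréchet derivative) at the final time below `κ M²`. Scale-invariant in `(M, T)`. A HYPOTHESIS
schema: `κ(s) < ∞` for every `s > 0` by the `L^∞` local theory (Giga–Inui–Matsui 1999) and, in the ancient limit,
by Seregin's Prop. 3.9 (bounded mild ancient solutions have bounded derivatives) — with NO explicit value in print
(crux idea universal-face-constants, lens `dual`; critic F1 lookup null). [cite: Seregin2014, Prop. 3.9] -/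
@[conjecture] def GradientProductionBound (s φ κ : ℝ) : Prop :=
  ∀ (t₀ T M : ℝ) (f u : ℝ → EuclideanSpace ℝ (Fin 3) → EuclideanSpace ℝ (Fin 3))
    (p : ℝ → EuclideanSpace ℝ (Fin 3) → ℝ), 0 < T → 0 < M → T * M ^ 2 = s →
    IsClassicalNSSolutionOn (Icc t₀ (t₀ + T)) 1 f u p →
    (∃ C : ℝ≥0∞, C < ⊤ ∧ ∀ t ∈ Icc t₀ (t₀ + T), ∫⁻ x, ‖u t x‖ₑ ^ 2 ≤ C) →
    (∀ t ∈ Icc t₀ (t₀ + T), ∀ x, ‖f t x‖ ≤ φ * M ^ 3) →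
    (∀ t ∈ Icc t₀ (t₀ + T), ∀ x, ‖u t x‖ ≤ M) →
    ∀ x, ‖fderiv ℝ (u (t₀ + T)) x‖ ≤ κ * M ^ 2

/-- «𝔄(s, c, φ) ≤ a» — SPEED-AMPLIFICATION BOUND: speed `≤ m` everywhere at time `t₀`, running bound `≤ c m` and
force `≤ φ m³` on the slab of length `T = s / m²` put the speed at the final time below `a m` (finite-energy classical
flows, `ν = 1`). A HYPOTHESIS schema; trivially true with `a = c` (`speedAmplificationBound_of_le`), the content is
`a < c` (crux idea universal-face-constants, lens `dual`). [folklore] -/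
@[conjecture] def SpeedAmplificationBound (s c φ a : ℝ) : Prop :=
  ∀ (t₀ T m : ℝ) (f u : ℝ → EuclideanSpace ℝ (Fin 3) → EuclideanSpace ℝ (Fin 3))
    (p : ℝ → EuclideanSpace ℝ (Fin 3) → ℝ), 0 < T → 0 < m → T * m ^ 2 = s →
    IsClassicalNSSolutionOn (Icc t₀ (t₀ + T)) 1 f u p →
    (∃ C : ℝ≥0∞, C < ⊤ ∧ ∀ t ∈ Icc t₀ (t₀ + T), ∫⁻ x, ‖u t x‖ₑ ^ 2 ≤ C) →
    (∀ t ∈ Icc t₀ (t₀ + T), ∀ x, ‖f t x‖ ≤ φ * m ^ 3) →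
    (∀ x, ‖u t₀ x‖ ≤ m) →
    (∀ t ∈ Icc t₀ (t₀ + T), ∀ x, ‖u t x‖ ≤ c * m) →
    ∀ x, ‖u (t₀ + T) x‖ ≤ a * m

/-- Sanity: the speed-amplification predicate holds trivially for every `a ≥ c` (the running bound read at the final
time) — its content is a constant `a < c`. [folklore] -/
theorem speedAmplificationBound_of_le {s c φ a : ℝ} (h : c ≤ a) : SpeedAmplificationBound s c φ a := by
  intro t₀ T m f u p hT hm _ _ _ _ _ hrun x
  have ht : t₀ + T ∈ Icc t₀ (t₀ + T) := ⟨by linarith, le_rfl⟩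
  exact (hrun (t₀ + T) ht x).trans (mul_le_mul_of_nonneg_right h hm.le)

/-- Monotonicity in the constant: a gradient bound with `κ` gives one with every `κ' ≥ κ`. [folklore] -/
theorem GradientProductionBound.mono {s φ κ κ' : ℝ} (h : GradientProductionBound s φ κ) (hκ : κ ≤ κ') :
    GradientProductionBound s φ κ' := by
  intro t₀ T M f u p hT hM hs hcl hen hfo hsp x
  exact (h t₀ T M f u p hT hM hs hcl hen hfo hsp x).trans (mul_le_mul_of_nonneg_right hκ (by positivity))

/-- Monotonicity in the constant: a speed bound with `a` gives one with every `a' ≥ a`. [folklore] -/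
theorem SpeedAmplificationBound.mono {s c φ a a' : ℝ} (h : SpeedAmplificationBound s c φ a) (ha : a ≤ a') :
    SpeedAmplificationBound s c φ a' := by
  intro t₀ T m f u p hT hm hs hcl hen hfo hst hrun x
  exact (h t₀ T m f u p hT hm hs hcl hen hfo hst hrun x).trans (mul_le_mul_of_nonneg_right ha hm.le)

/-! ## §2 The register's window numbers (wide rates, `Rigid`), as real expressions -/

/-- growth window `w_k = 4bβ log N_{k+1} / A_k` (`Rigid`: `c₅ = 4bβ` and window equality).
[cite: Palasek2026ElementaryModel, §3.3] -/
def window (k : ℕ) : ℝ :=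
  4 * TowerRates.wide.b * TowerRates.wide.β * Real.log (TowerRates.wide.N (k + 1)) / TowerRates.wide.A k

/-- window length in CEILING units: `w_k (5/3 · Y_{k+1})²` (`= 3826.5` at `k = 0`). [cite: Palasek2026ElementaryModel, §3.3] -/
def windowCeil (k : ℕ) : ℝ := window k * ((5 / 3) * TowerRates.wide.Y (k + 1)) ^ 2

/-- strain floor at `τ_{k+1}` in ceiling units: `A_{k+1} / (5/3 · Y_{k+1})² = (9/25) N_{k+1}^{2-β}` (`= 0.05775` at
`k = 0`). [cite: Palasek2026ElementaryModel, §3.1] -/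
def gradFloorCeil (k : ℕ) : ℝ := TowerRates.wide.A (k + 1) / ((5 / 3) * TowerRates.wide.Y (k + 1)) ^ 2

/-- window force in ceiling units: `c₄ Y_k ≤ c₁ Y_k = Y_k` over `M³` (`= 1.36e-8` at `k = 0`). [cite: Palasek2026ElementaryModel, §3.3] -/
def forceCeil (k : ℕ) : ℝ := TowerRates.wide.Y k / ((5 / 3) * TowerRates.wide.Y (k + 1)) ^ 3

/-- window length in START units `m = (5/3) Y_k`: `w_k m²` (`= 905.0` at `k = 0`). [cite: Palasek2026ElementaryModel, §3.3] -/
def windowStart (k : ℕ) : ℝ := window k * ((5 / 3) * TowerRates.wide.Y k) ^ 2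

/-- running bound over start speed inside window `k`: `(5/3) Y_{k+1} / ((5/3) Y_k) = Y_{k+1} / Y_k` (`= 2.056` at
`k = 0`). [cite: Palasek2026ElementaryModel, §3.3] -/
def runRatio (k : ℕ) : ℝ := TowerRates.wide.Y (k + 1) / TowerRates.wide.Y k

/-- floor at `τ_{k+1}` over start speed: `Y_{k+1} / ((5/3) Y_k)` (`= 1.234` at `k = 0`). [cite: Palasek2026ElementaryModel, §3.3] -/
def floorOverStart (k : ℕ) : ℝ := TowerRates.wide.Y (k + 1) / ((5 / 3) * TowerRates.wide.Y k)

/-- window force in start units: `Y_k / ((5/3) Y_k)³`. [cite: Palasek2026ElementaryModel, §3.3] -/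
def forceStart (k : ℕ) : ℝ := TowerRates.wide.Y k / ((5 / 3) * TowerRates.wide.Y k) ^ 3

/-- ANCHORED level-`0` window (start speed sharpened to `c₁ Y₀` by the global anchor + continuity): `w₀ Y₀²`
(`= 325.8`). [cite: Palasek2026ElementaryModel, §3.3] -/
def windowAnch : ℝ := window 0 * TowerRates.wide.Y 0 ^ 2

/-- ANCHORED running bound `(5/3) Y₁ / Y₀` (`= 3.427`). [cite: Palasek2026ElementaryModel, §3.3] -/
def runAnch : ℝ := (5 / 3) * TowerRates.wide.Y 1 / TowerRates.wide.Y 0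

/-- ANCHORED floor ratio `Y₁ / Y₀` (`= 256^{13/100} = 2.056`). [cite: Palasek2026ElementaryModel, §3.3] -/
def floorAnch : ℝ := TowerRates.wide.Y 1 / TowerRates.wide.Y 0

/-- ANCHORED window force `Y₀ / Y₀³`. [cite: Palasek2026ElementaryModel, §3.3] -/
def forceAnch : ℝ := TowerRates.wide.Y 0 / TowerRates.wide.Y 0 ^ 3

/-- The velocity scales of the wide rates are positive. [folklore] -/
theorem Y_pos (k : ℕ) : 0 < TowerRates.wide.Y k := Real.rpow_pos_of_pos (TowerRates.wide.N_pos k) _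

/-- **Under rigidity the growth window of level `k + 1` has length exactly `window k`** (`Rigid.window_eq` with
`c₅ = 4bβ`). [cite: Palasek2026ElementaryModel, §3.3] -/
theorem window_eq_of_rigid {S : Schedule TowerRates.wide} (hR : S.Rigid) (k : ℕ) :
    S.τ (k + 1) - S.τ k = window k := by
  rw [hR.window_eq k, hR.c₅_eq]
  simp only [window]
  ring

/-- The windows are positive. [folklore] -/
theorem window_pos (k : ℕ) : 0 < window k := by
  have hb : 0 < TowerRates.wide.b := lt_trans zero_lt_one TowerRates.wide.one_lt_b
  have hβ : 0 < TowerRates.wide.β := lt_trans two_pos TowerRates.wide.two_lt_β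
  have hlog : 0 < Real.log (TowerRates.wide.N (k + 1)) := Real.log_pos (TowerRates.wide.one_lt_N _)
  have hA : 0 < TowerRates.wide.A k := TowerRates.wide.A_pos k
  simp only [window]
  positivity

/-- On the growth window `[τ_k, τ_{k+1}]` of a schedule with `c₁ = 1` the force is at most `Y_k` pointwise
(`Schedule.push_small` on the whole closed window and `c₄ ≤ c₁`). [cite: Palasek2026ElementaryModel, §3.3] -/
theorem force_le_Y_of_rigid {S : Schedule TowerRates.wide} (hR : S.Rigid) (k : ℕ) {t : ℝ}
    (ht : t ∈ Icc (S.τ k) (S.τ (k + 1))) (x : EuclideanSpace ℝ (Fin 3)) :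
    ‖S.f t x‖ ≤ TowerRates.wide.Y k := by
  have h1 := S.push_small k t ht x
  have h2 : S.c₄ ≤ 1 := by
    have := S.c₄_le
    rwa [hR.c₁_eq] at this
  have hY := Y_pos k
  nlinarith

/-! ## §3 `NoStageAbove k`: level `k + 1` is empty -/

/-- **NO STAGE ABOVE LEVEL `k`**: no pinned (`Λ = 8`, `θ = 6/5`), rigid, quiet schedule on the wide-base rates carries
a globally anchored registered stage at level `k + 1` (route-G margins, `ν = 1`) — the negation of the rung
`RungG (k + 1)` (`noStageAbove_iff_not_rungG`). [cite: Palasek2026ElementaryModel, §4] -/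
@[conjecture] def NoStageAbove (k : ℕ) : Prop :=
  ∀ S : Schedule TowerRates.wide, S.Pins 8 (6 / 5) → S.Rigid → S.Quiet →
    IsEmpty (Stage 1 TowerRates.wide S (Margins.routeG TowerRates.wide) (k + 1))

/-- `NoStageAbove k` is exactly `¬ RungG (k + 1)`. [folklore] -/
theorem noStageAbove_iff_not_rungG (k : ℕ) : NoStageAbove k ↔ ¬ RungG (k + 1) := by
  constructor
  · rintro h ⟨S, hP, hR, hQ, ⟨s⟩⟩
    exact (h S hP hR hQ).false s
  · intro h S hP hR hQ
    exact ⟨fun s => h ⟨S, hP, hR, hQ, ⟨s⟩⟩⟩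

/-- Level `1` empty ⇔ the crux of record is false (`RungG 1` is `EpisodeBaseG` verbatim). [folklore] -/
theorem noStageAbove_zero_iff : NoStageAbove 0 ↔ ¬ EpisodeBaseG :=
  noStageAbove_iff_not_rungG 0

/-- Level `1` empty ⇒ the crux of record is false (kernel-checked unfolding of `EpisodeBaseG`; the sketch's one
theorem). [folklore] -/
theorem not_episodeBaseG_of_noStageAbove_zero (h : NoStageAbove 0) : ¬ EpisodeBaseG :=
  noStageAbove_zero_iff.1 h

/-- `NoStageAbove` is monotone in the level: an empty level empties every higher one (the rungs form a ladder,
`RungG.mono`). [folklore] -/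
theorem NoStageAbove.mono {k k' : ℕ} (h : NoStageAbove k) (hk : k ≤ k') : NoStageAbove k' :=
  (noStageAbove_iff_not_rungG k').2 fun h' =>
    (noStageAbove_iff_not_rungG k).1 h (h'.mono (Nat.succ_le_succ hk))

/-- **Sterile closure, flagged**: an empty level `k + 1` makes heredity FROM `k + 1` hold VACUOUSLY (there is no stage
to extend). So a dual door firing at window `1` would "close" `HeredityFrom 2` (item 19250) without content — the
planner reads such a closure as the register's death above level `1`, not as heredity. [folklore] -/
theorem NoStageAbove.heredityFrom {k : ℕ} (h : NoStageAbove k) : HeredityFrom (k + 1) := by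
  intro S hP hR hQ j hj s
  obtain ⟨i, rfl⟩ := Nat.exists_eq_add_of_le' hj
  exact ((h.mono (Nat.le_add_left k i) S hP hR hQ).false s).elim

/-- … and heredity AT every level `j ≥ k + 1` holds vacuously. [folklore] -/
theorem NoStageAbove.heredityAt {k j : ℕ} (h : NoStageAbove k) (hj : k + 1 ≤ j) : HeredityAt j :=
  (h.heredityFrom).heredityAt hj

/-- **The honest bite one level up**: if level `k + 1` is inhabited (`RungG (k + 1)`) but level `k + 2` is empty, then
heredity AT `k + 1` is false. At `k = 0`: `EpisodeBaseG → NoStageAbove 1 → ¬ HeredityAtOne`. [folklore] -/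
theorem NoStageAbove.not_heredityAt {k : ℕ} (h : NoStageAbove (k + 1)) (hK : RungG (k + 1)) :
    ¬ HeredityAt (k + 1) := by
  intro hH
  obtain ⟨S, hP, hR, hQ, ⟨s⟩⟩ := hK
  obtain ⟨s', -⟩ := hH S hP hR hQ s
  exact (h S hP hR hQ).false s'

/-- At `k = 0`, by name: the crux and an empty level `2` refute the first rung `HeredityAtOne`. [folklore] -/
theorem NoStageAbove.not_heredityAtOne (h : NoStageAbove 1) (hK : EpisodeBaseG) : ¬ HeredityAtOne :=
  h.not_heredityAt (rungG_one_iff.2 hK)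

end UniversalFace

end Summit.NavierStokesRegularity.FluidComputer.PalasekTowerClayBridge

end
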